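import Literature.Probability.Distributions.GaussianVectorTilt
import Mathlib.Probability.Distributions.Gaussian.HasGaussianLaw.Basic
import HarnessLib

/-!
# Complex exponential moments of a centred Gaussian vector:
# `E[exp(Σ_i (c_i + i v_i) Z_i)] = exp(½(c + iv)ᵀ C (c + iv))`

Topic `Probability/Distributions`, namespace `Literature.Probability.Distributions`.  Sequel to
`GaussianVectorTilt.lean` (the finite-dimensional Cameron–Martin formula
`Law(Z + Cc) = exp(⟨c,z⟩ − ⟨c,Cc⟩/2)·Law(Z)` for a centred Gaussian vector `Z = (Z_i)_{i∈ι}` given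
through Mathlib's `HasGaussianLaw`).  Combining the tilt with the Gaussian characteristic
functional (Mathlib `HasGaussianLaw.charFunDual_map_eq_fun`) gives the exponential moment with a
COMPLEX linear exponent — the single Gaussian identity through which a renormalisation-group /
cluster-expansion step integrates out a fluctuation field against complex (analytic) activities
(Glimm–Jaffe, *Quantum Physics*, §9.1, (9.1.19)–(9.1.22): "`∫ e^{iφ(f)} dφ_C = e^{-⟨f,Cf⟩/2}`" and
its analytic continuation; Bauerschmidt–Brydges–Slade 2019, Exercise 2.1.9 / (2.1.10)
`E_C(e^{(φ,f)}) = e^{½(f,Cf)}` "for `f ∈ ℂⁿ`"):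

* `integral_comp_add_of_hasGaussianLaw` — the tilt in integral form for Banach-valued test
  functions: `E[G(Z + a)] = E[exp(⟨c,Z⟩ − ⟨c,a⟩/2) • G(Z)]`, `a = Cc`;
* `variance_sum_mul_of_hasGaussianLaw` — `Var(Σ_i v_i Z_i) = Σ_{i,j} v_i v_j C_{ij}`;
* **`integral_cexp_sum_mul_I_of_hasGaussianLaw`** — `E[e^{i Σ v_i Z_i}] = e^{−½ vᵀCv}`;
* **`integral_cexp_complexLinear_of_hasGaussianLaw`** — for real `c, v` and `a = Cc`, `b = Cv`:
  `E[exp(Σ_i (c_i + i v_i) Z_i)] = exp(½⟨c,a⟩ − ½⟨v,b⟩ + i⟨v,a⟩)` `= exp(½(c+iv)ᵀC(c+iv))`.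

## References

* J. Glimm, A. Jaffe, *Quantum Physics. A Functional Integral Point of View*, 2nd ed. (Springer
  1987), §9.1. [GlimmJaffeQP1987]
* R. Bauerschmidt, D. C. Brydges, G. Slade, LNM 2242 (2019), §2.1 (Exercise 2.1.9, (2.1.10)).
  [BauerschmidtBrydgesSlade2019RG]
* V. I. Bogachev, *Gaussian Measures* (AMS 1998), Cor. 2.4.3. [Bogachev1998]
-/

noncomputable section

open MeasureTheory ProbabilityTheory Complex
open scoped ENNReal NNReal

namespace Literature.Probability.Distributions

variable {Ω : Type*} [MeasurableSpace Ω] {P : Measure Ω} {ι : Type*} [Fintype ι]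

/-- **The Cameron–Martin tilt, integral form, Banach-valued test functions**: with `a = Cc`,
`E[G(Z + a)] = E[exp(⟨c,Z⟩ − ⟨c,a⟩/2) • G(Z)]` (no integrability hypothesis: both Bochner integrals
vanish together). [cite: Bogachev1998, Cor. 2.4.3 (finite-dimensional Cameron–Martin formula)] -/
theorem integral_comp_add_of_hasGaussianLaw {E : Type*} [NormedAddCommGroup E] [NormedSpace ℝ E]
    [CompleteSpace E] (Z : ι → Ω → ℝ)
    (hZ : HasGaussianLaw (fun ω i => Z i ω) P) (h0 : ∀ i, ∫ ω, Z i ω ∂P = 0)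
    (c a : ι → ℝ) (ha : ∀ i, a i = ∑ j, cov[Z i, Z j; P] * c j)
    {G : (ι → ℝ) → E} (hG : StronglyMeasurable G) :
    ∫ ω, G (fun i => Z i ω + a i) ∂P =
      ∫ ω, Real.exp (∑ i, c i * Z i ω - (∑ i, c i * a i) / 2) • G (fun i => Z i ω) ∂P := by
  have hm : AEMeasurable (fun ω i => Z i ω + a i) P :=
    (by fun_prop : Measurable fun z : ι → ℝ => fun i => z i + a i).comp_aemeasurable
      hZ.aemeasurable
  rw [← integral_map hm hG.aestronglyMeasurable,
    map_add_eq_withDensity_of_hasGaussianLaw Z hZ h0 c a ha,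
    integral_withDensity_eq_integral_toReal_smul (by fun_prop)
      (Filter.Eventually.of_forall fun _ => ENNReal.ofReal_lt_top),
    integral_map hZ.aemeasurable]
  · refine integral_congr_ae (Filter.Eventually.of_forall fun ω => ?_)
    simp only
    rw [ENNReal.toReal_ofReal (Real.exp_nonneg _)]
  · have hsc : Measurable fun z : ι → ℝ =>
        (ENNReal.ofReal (Real.exp (∑ i, c i * z i - (∑ i, c i * a i) / 2))).toReal := by fun_prop
    exact hsc.aestronglyMeasurable.smul hG.aestronglyMeasurable

/-- **Variance of a linear functional of a Gaussian vector**: `Var(Σ_i v_i Z_i) = Σ_iΣ_j v_i v_j Cov(Z_i,Z_j)`.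
[folklore] -/
theorem variance_sum_mul_of_hasGaussianLaw (Z : ι → Ω → ℝ)
    (hZ : HasGaussianLaw (fun ω i => Z i ω) P) (v : ι → ℝ) :
    Var[fun ω => ∑ i, v i * Z i ω; P] = ∑ i, ∑ j, v i * v j * cov[Z i, Z j; P] := by
  classical
  have hprob : IsProbabilityMeasure P := hZ.isProbabilityMeasure
  have hL2 : ∀ i, MemLp (Z i) 2 P := fun i => (hZ.eval i).memLp_two
  have hYL2 : MemLp (fun ω => ∑ j, v j * Z j ω) 2 P := by
    have := memLp_finsetSum' Finset.univ (fun j _ => (hL2 j).const_mul (v j) (p := 2) (μ := P))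
    convert this using 1
    funext ω; simp
  rw [← covariance_self hYL2.aemeasurable,
    covariance_fun_sum_left (fun j => (hL2 j).const_mul (v j)) hYL2]
  refine Finset.sum_congr rfl fun i _ => ?_
  rw [covariance_const_mul_left, covariance_fun_sum_right (fun j => (hL2 j).const_mul (v j)) (hL2 i),
    Finset.mul_sum]
  refine Finset.sum_congr rfl fun j _ => ?_
  rw [covariance_const_mul_right]
  ring

/-- **The Gaussian characteristic functional**: `E[exp(i Σ_i v_i Z_i)] = exp(−½ Σ_{i,j} v_iv_jC_{ij})`
for a centred Gaussian vector. [cite: GlimmJaffeQP1987, §9.1 (9.1.19) (characteristic functional of a Gaussian measure)] -/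
theorem integral_cexp_sum_mul_I_of_hasGaussianLaw (Z : ι → Ω → ℝ)
    (hZ : HasGaussianLaw (fun ω i => Z i ω) P) (h0 : ∀ i, ∫ ω, Z i ω ∂P = 0) (v : ι → ℝ) :
    ∫ ω, cexp ((∑ i, v i * Z i ω : ℝ) * I) ∂P =
      cexp (-(((∑ i, ∑ j, v i * v j * cov[Z i, Z j; P] : ℝ) : ℂ) / 2)) := by
  classical
  have hprob : IsProbabilityMeasure P := hZ.isProbabilityMeasure
  -- the continuous linear functional `z ↦ Σ v_i z_i`
  set L : StrongDual ℝ (ι → ℝ) := ∑ i, v i • (ContinuousLinearMap.proj i : (ι → ℝ) →L[ℝ] ℝ)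
    with hL
  have hLapp : ∀ z : ι → ℝ, L z = ∑ i, v i * z i := by
    intro z
    simp [hL]
  have hchar := hZ.charFunDual_map_eq_fun L
  rw [charFunDual_apply, integral_map hZ.aemeasurable (by fun_prop)] at hchar
  simp only [hLapp] at hchar
  have hmean : ∫ ω, ∑ i, v i * Z i ω ∂P = 0 := by
    have hL2 : ∀ i, MemLp (Z i) 2 P := fun i => (hZ.eval i).memLp_two
    rw [integral_finsetSum _ (fun j _ => ((hL2 j).integrable one_le_two).const_mul (v j))]
    simp [integral_const_mul, h0]
  rw [hmean, variance_sum_mul_of_hasGaussianLaw Z hZ v] at hchar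
  rw [hchar]
  congr 1
  push_cast
  ring

/-- **Complex exponential moments of a centred Gaussian vector.**  For real `c, v : ι → ℝ` and
`a = Cc`, `b = Cv` (`C_{ij} = Cov(Z_i,Z_j)`):
`E[exp(Σ_i (c_i + i v_i) Z_i)] = exp(½⟨c,a⟩ − ½⟨v,b⟩ + i⟨v,a⟩)`, i.e. `exp(½(c+iv)ᵀC(c+iv))`
(Cameron–Martin tilt by `c`, then the characteristic functional at `v`).
[cite: BauerschmidtBrydgesSlade2019RG, §2.1, Exercise 2.1.9 / (2.1.10) (E_C(e^{(φ,f)}) = e^{½(f,Cf)} for complex f)] -/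
theorem integral_cexp_complexLinear_of_hasGaussianLaw (Z : ι → Ω → ℝ)
    (hZ : HasGaussianLaw (fun ω i => Z i ω) P) (h0 : ∀ i, ∫ ω, Z i ω ∂P = 0)
    (c v a b : ι → ℝ) (ha : ∀ i, a i = ∑ j, cov[Z i, Z j; P] * c j)
    (hb : ∀ i, b i = ∑ j, cov[Z i, Z j; P] * v j) :
    ∫ ω, cexp (∑ i, ((c i : ℂ) + (v i : ℂ) * I) * (Z i ω : ℂ)) ∂P =
      cexp (((∑ i, c i * a i : ℝ) : ℂ) / 2 - ((∑ i, v i * b i : ℝ) : ℂ) / 2 +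
        ((∑ i, v i * a i : ℝ) : ℂ) * I) := by
  classical
  have hprob : IsProbabilityMeasure P := hZ.isProbabilityMeasure
  set s : ℝ := ∑ i, c i * a i with hs
  -- the test function `G(z) = e^{s/2} · exp(i Σ v_i z_i)`
  set G : (ι → ℝ) → ℂ := fun z => (Real.exp (s / 2) : ℂ) * cexp ((∑ i, v i * z i : ℝ) * I) with hG
  have hGm : StronglyMeasurable G := by
    refine Measurable.stronglyMeasurable ?_
    simp only [hG]
    fun_prop
  -- pointwise: the integrand is the tilt density times `G`
  have hpt : ∀ ω, cexp (∑ i, ((c i : ℂ) + (v i : ℂ) * I) * (Z i ω : ℂ)) =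
      Real.exp (∑ i, c i * Z i ω - s / 2) • G (fun i => Z i ω) := by
    intro ω
    have hexp : ∑ i, ((c i : ℂ) + (v i : ℂ) * I) * (Z i ω : ℂ) =
        ((∑ i, c i * Z i ω : ℝ) : ℂ) + ((∑ i, v i * Z i ω : ℝ) : ℂ) * I := by
      push_cast
      rw [Finset.sum_mul, ← Finset.sum_add_distrib]
      refine Finset.sum_congr rfl fun i _ => ?_
      ring
    rw [hexp]
    simp only [hG, Complex.real_smul]
    rw [← mul_assoc, ← Complex.ofReal_mul, ← Real.exp_add, Complex.ofReal_exp, ← Complex.exp_add]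
    congr 1
    push_cast
    ring
  simp_rw [hpt]
  rw [← integral_comp_add_of_hasGaussianLaw Z hZ h0 c a ha hGm]
  -- `E[G(Z + a)] = e^{s/2} e^{i⟨v,a⟩} E[e^{iΣv_iZ_i}]`
  simp only [hG]
  have hsplit : ∀ ω, (Real.exp (s / 2) : ℂ) * cexp ((∑ i, v i * (Z i ω + a i) : ℝ) * I) =
      ((Real.exp (s / 2) : ℂ) * cexp ((∑ i, v i * a i : ℝ) * I)) * cexp ((∑ i, v i * Z i ω : ℝ) * I) := by
    intro ω
    rw [mul_assoc, ← Complex.exp_add]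
    congr 2
    push_cast
    simp only [mul_add, Finset.sum_add_distrib, add_mul]
    ring
  simp_rw [hsplit]
  rw [integral_const_mul, integral_cexp_sum_mul_I_of_hasGaussianLaw Z hZ h0 v]
  -- identify `Σ_{ij} v_i v_j C_{ij} = Σ_i v_i b_i`
  have hbb : (∑ i, ∑ j, v i * v j * cov[Z i, Z j; P]) = ∑ i, v i * b i := by
    refine Finset.sum_congr rfl fun i _ => ?_
    rw [hb, Finset.mul_sum]
    refine Finset.sum_congr rfl fun j _ => ?_
    ring
  rw [hbb, Complex.ofReal_exp, ← Complex.exp_add, ← Complex.exp_add]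
  congr 1
  push_cast
  ring

end Literature.Probability.Distributions

end
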